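import Literature.MathematicalPhysics.QuantumFieldTheory.Balaban1983to89.Node00.OpsYCubeDirInverseSymm
import Literature.MathematicalPhysics.QuantumFieldTheory.Balaban1983to89.B9KnitTransporterLocalityY
import Literature.MathematicalPhysics.QuantumFieldTheory.Balaban1983to89.B9BackgroundsKLevelV1R

/-!
# BalabanUVNodes ∕ N06 ([B9], `Dag.B9_main`) — THE P4 CUBE LETTER `G′_□(U) := GpDirY x.toKIdx □ (parKnitY x.toKIdx) (S □) U` AT THE RECORD: the four law rows
# `hOloc ∕ hOlocT ∕ hOagr ∕ hOsym` of the knit certificate's generic cube letter `O`, READ at node00-def-Y's Dirichlet cube inverse (✓`Node00.OpsYCubeDirInverse` E,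
# ✓`Node00.OpsYCubeDirInverseSymm` F) and the knit transporter (✓`B9KnitTransporterLocalityY`), in the binder shapes of the heads «KE₉X-A» ∕ «KESC-A»
Track A of `YM-PLAN.md` (cell `pub-ymgap`, HUMAN RULING D-0062), node **N06**.  Seat `pub-ymgap-dag-n06-d` g32 (door «KE₁₀X-A», node00-def-Y (Q1) road P4).

T. Bałaban, *Propagators for lattice gauge theories in a background field*, Commun. Math. Phys. **99** (1985) 389–434 [Balaban1985BackgroundPropagators] = [B9]: p. 394 L24–33
(«Δ′_a↾Ω₀ = Ω₀Δ′_aΩ₀ … Its inverse is denoted by G′ … They depend on the configuration U restricted to Ω₀»), p. 408 L35 – p. 409 L5 (the sequence `{Ω_n(□)}` and `G′_□(U)`),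
(3.87)–(3.88) p. 409, p. 410 L14–15, Thm 3.11 p. 416 («symmetric»), (3.19) p. 393, (3.35) p. 396.

WHAT.  At `O x □ := GpDirY x.toKIdx □ (parKnitY x.toKIdx) (S x □)` (`S □ = Ω₀(□)`, a binder until dag-n06-c's D3 names the placement):
* §1 (any index, any transporter) ★ `localInverse_laws_hTY_GpDirY`: BOTH local-inverse laws `h_□Δ′_a(U)G′_□(U)h_□ = h_□² = h_□G′_□(U)Δ′_a(U)h_□` at the partition of record from
  `supp h_□ ⊆ S` and `IsUnit (Ω₀Δ′_{a,□}(U)Ω₀ ⊕ 1)` alone (E's ROW law + F's COLUMN law + ✓`nearH_of_hTY_ne_zero` ∕ ✓`nearH_of_mem_stencilY_hTY`) — the `hOloc ∕ hOlocT` sockets;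
  `isSymmTr_GpDirY_parKnitY_of_unitary` (F's `GpDirY_parKnitY_isSymmTr` at `G := U(N)`) — the `hOsym` socket behind the knit legs' unitarity.
* §2 (the certificate's carrier `bg9YR M_N(ℂ) SU(N) R₁ R₂ x`, `cfg := id`) ★ `hOsym_GpDirY_of_unitaryLegs`: the head's REGIME-ONLY-guarded symmetry row at the letter from
  `MemOfFam SU(N) R₁` and the displayed letter fact `hparU : Reg335 c α₀ U → ∀ z w, parKnitY U z w ∈ U(N)` (in the tree today inside the [B7] Prop-2 window only —
  ✓`parKnitY_mem_unitary_of_reg335P`; unconditionally it is the `mlog`-convention item «`star (mlog W) = −mlog W` for every unitary `W`», node00-def-Y (Q-sym) WORD 2026-08-31);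
  ★ `hOagr_GpDirY_of_agreeWalkYO`: the locality row from ✓`GpDirY_parKnitY_congr_of_agreeWalkYO` given `S □ ⊆ near □` and `knitReachY … (S □) ⊆ near □`.
HONEST FRAMING.  Helper (kernel bookkeeping over landed theorems; 0 `def`, 0 `sorry`, standard axioms), COUNT-NEUTRAL (`--supports stmt-QuantumFields-27239 --as helper`); Cor. 3.6's
`IsUnit`, the legs' unitarity, `supp h_□ ⊆ S □` and the two inclusions in `near □` are DISPLAYED where used; nothing of [B9] asserted; N06 NOT discharged; K1 NOT closed; nothing
continuum ∕ OS ∕ mass gap ∕ Clay.  NEW file.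
-/
noncomputable section

namespace Summit.QuantumFields.YangMills.BalabanUVNodes.N06CubeDirInverseAtRecord
open Literature.MathematicalPhysics.QuantumFieldTheory.Balaban1983to89
open Literature.MathematicalPhysics.QuantumFieldTheory.Balaban1983to89.Node00
open Literature.MathematicalPhysics.QuantumFieldTheory.Balaban1983to89.B6KLevelCensusIndexV1 (KIdx)
open Literature.MathematicalPhysics.QuantumFieldTheory.Balaban1983to89.B6Cover236MultiLevelBlocks (cubes)
open Literature.MathematicalPhysics.QuantumFieldTheory.Balaban1983to89.B9PinMembersKLevelV1 (MemberY)
open Literature.MathematicalPhysics.QuantumFieldTheory.Balaban1983to89.B7Prop2SpecialUnitary (specialUnitaryUnits specialUnitaryUnits_le_unitaryUnits)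
open Literature.MathematicalPhysics.QuantumFieldTheory.Balaban1983to89.B7Prop2Explicit (unitaryUnits)
open Literature.MathematicalPhysics.QuantumFieldTheory.Balaban1983to89.B9BackgroundsKLevelV1R (RegFamY MemOfFam bg9YR mem_of_reg335R)
open Literature.MathematicalPhysics.QuantumFieldTheory.Balaban1983to89.B9Thm37CubeCoverCommutators (cutMulY hTY)
open Literature.MathematicalPhysics.QuantumFieldTheory.Balaban1983to89.B9Thm311ReadingCoords (IsSymmTr)
open Literature.MathematicalPhysics.QuantumFieldTheory.Balaban1983to89.B9B8AveragingJunction (parKnitY)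
open Literature.MathematicalPhysics.QuantumFieldTheory.Balaban1983to89.B9Cor36GCubeLocDefectTransfer (nearH_of_hTY_ne_zero)
open Literature.MathematicalPhysics.QuantumFieldTheory.Balaban1983to89.B9WalkLettersOpsO (agreeWalkYO)
open Literature.MathematicalPhysics.QuantumFieldTheory.Balaban1983to89.B9KnitTransporterLocalityY (knitReachY GpDirY_parKnitY_congr_of_agreeWalkYO)
open OpsYLocalInverseSeq (nearH_of_mem_stencilY_hTY)
open OpsYCubeDirInverse (padDeltaCubeY GpDirY cutMulY_deltaPrimeAY_GpDirY_cutMulY)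
open OpsYCubeDirInverseSymm (cutMulY_GpDirY_deltaPrimeAY_cutMulY GpDirY_parKnitY_isSymmTr)
open scoped Matrix.Norms.L2Operator

variable {d ℓ : ℕ} {hd : 1 ≤ d + 1} {hL : Odd (ℓ + 1) ∧ 1 < ℓ + 1} {b₀ b₁ : ℝ}

/-! ## §1 At any index: the two local-inverse laws at `h_□`, and symmetry behind unitary legs -/

section Index

variable {𝔸 : Type} [NormedRing 𝔸] [NormedAlgebra ℂ 𝔸] [CompleteSpace 𝔸]
variable (i : KIdx d ℓ hd hL b₀ b₁) (c : ↥(cubes (toKT i).D.toDomains)) (par : SiteParY 𝔸 i)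

/-- ★ **BOTH LOCAL-INVERSE LAWS OF PRINT's `G′_□(U) = (Ω₀Δ′_{a,□}(U)Ω₀)⁻¹` AT THE PARTITION OF RECORD `h_□`**, any site transporter, from `supp h_□ ⊆ S = Ω₀(□)` and
`IsUnit (Ω₀Δ′_{a,□}(U)Ω₀ ⊕ 1)` alone: `h_□·Δ′_a(U)·G′_□(U)·h_□ = h_□²` (E's ROW law, `supp h_□ ⊂ NearH □`) and `h_□·G′_□(U)·Δ′_a(U)·h_□ = h_□²` (F's COLUMN law, one stencil
around `supp h_□` still near □) — the `hOloc ∕ hOlocT` rows of the knit certificate at the P4 letter (the `GpCubeY` face is ✓`OpsYLocalInverseSeq.localInverse_laws_hTY_GpCubeY`).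
[cite: Balaban1985BackgroundPropagators, (3.87)–(3.88) p.409, p.408 l.35–p.409 l.5, p.394 L24–33] -/
theorem localInverse_laws_hTY_GpDirY {S : Finset (SiteY i)} (hS : ∀ z, hTY i c z ≠ 0 → z ∈ S) {U : CfgY 𝔸 i}
    (hU : IsUnit (padDeltaCubeY i c par S U)) :
    cutMulY (hTY i c) * deltaPrimeAY i par U * GpDirY i c par S U * cutMulY (hTY i c) = cutMulY (hTY i c) * cutMulY (hTY i c) ∧
    cutMulY (hTY i c) * GpDirY i c par S U * deltaPrimeAY i par U * cutMulY (hTY i c) = cutMulY (hTY i c) * cutMulY (hTY i c) :=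
  ⟨cutMulY_deltaPrimeAY_GpDirY_cutMulY i c par hU (hTY i c) hS fun _ hz => nearH_of_hTY_ne_zero i c hz,
    cutMulY_GpDirY_deltaPrimeAY_cutMulY i c par hU (hTY i c) hS fun _ _ hw hz => nearH_of_mem_stencilY_hTY i c hw hz⟩

end Index

section IndexTr

variable {N : ℕ} (i : KIdx d ℓ hd hL b₀ b₁) (c : ↥(cubes (toKT i).D.toDomains))

/-- **`G′_□(U; parKnitY)` IS SYMMETRIC BEHIND UNITARY LEGS**: F's `GpDirY_parKnitY_isSymmTr` at `G := U(N)` — the primitive under the knit certificate's `hOsym` row at the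
P4 letter (what remains displayed is the letter fact `parKnitY U z w ∈ U(N)`). [cite: Balaban1985BackgroundPropagators, (3.24)–(3.25) p.394, p.409, Thm 3.11 p.416] -/
theorem isSymmTr_GpDirY_parKnitY_of_unitary (S : Finset (SiteY i)) {U : CfgY (Matrix (Fin N) (Fin N) ℂ) i}
    (hU : ∀ μ y, U μ y ∈ unitaryUnits (Matrix (Fin N) (Fin N) ℂ)) (hpar : ∀ z w : SiteY i, parKnitY i U z w ∈ unitaryUnits (Matrix (Fin N) (Fin N) ℂ)) :
    IsSymmTr (fun _ => (1 : ℝ)) (GpDirY i c (parKnitY i) S U) :=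
  GpDirY_parKnitY_isSymmTr i c le_rfl S hU hpar

end IndexTr

/-! ## §2 At the certificate's carrier `bg9YR M_N(ℂ) SU(N) R₁ R₂ x` (`cfg := id`): the `hOsym` and `hOagr` rows at the letter -/

section Record

variable {Mstar N : ℕ} (x : MemberY d ℓ hd hL b₀ b₁ Mstar)

/-- ★ **THE `hOsym` ROW AT THE P4 LETTER** — `G′_□(U; parKnitY) = GpDirY x.toKIdx □ (parKnitY x.toKIdx) (S □) U` is symmetric for the weight-one trace pairing for every
`U` of the certificate's (3.35)-class `Reg335 c α₀ U` (`SU(N)`-valued by `MemOfFam SU(N) R₁`), GIVEN the displayed letter fact `hparU` «the knit legs are `U(N)`-valued on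
the class» (tree: inside the [B7] Prop-2 window, ✓`parKnitY_mem_unitary_of_reg335P`; unconditionally = the `mlog`-convention item).
[cite: Balaban1985BackgroundPropagators, Thm 3.11 p.416 («symmetric»), (3.24)–(3.25) p.394, (3.19) p.393, (3.35) p.396] -/
theorem hOsym_GpDirY_of_unitaryLegs {R₁ R₂ : RegFamY d ℓ hd hL b₀ b₁ Mstar (Matrix (Fin N) (Fin N) ℂ)} (hGR : MemOfFam (specialUnitaryUnits (Fin N)) R₁)
    (S : ↥(cubes x.toKIdx.D.toDomains) → Finset (SiteY x.toKIdx)) {c α₀ : ℝ}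
    (hparU : ∀ U : (bg9YR (Matrix (Fin N) (Fin N) ℂ) (specialUnitaryUnits (Fin N)) R₁ R₂ x).Cfg,
      (bg9YR (Matrix (Fin N) (Fin N) ℂ) (specialUnitaryUnits (Fin N)) R₁ R₂ x).Reg335 c α₀ U →
        ∀ z w : SiteY x.toKIdx, parKnitY x.toKIdx U z w ∈ unitaryUnits (Matrix (Fin N) (Fin N) ℂ))
    {U : (bg9YR (Matrix (Fin N) (Fin N) ℂ) (specialUnitaryUnits (Fin N)) R₁ R₂ x).Cfg}
    (hU : (bg9YR (Matrix (Fin N) (Fin N) ℂ) (specialUnitaryUnits (Fin N)) R₁ R₂ x).Reg335 c α₀ U) (c' : ↥(cubes x.toKIdx.D.toDomains)) :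
    IsSymmTr (fun _ => (1 : ℝ)) (GpDirY x.toKIdx c' (parKnitY x.toKIdx) (S c') U) :=
  isSymmTr_GpDirY_parKnitY_of_unitary x.toKIdx c' (S c') (fun μ y => specialUnitaryUnits_le_unitaryUnits (mem_of_reg335R hGR x hU μ y)) (hparU U hU)

/-- ★ **THE `hOagr` ROW AT THE P4 LETTER** (`cfg := id`): two configurations agreeing near □ in the walk reading's sense `agreeWalkYO … near □` give the same `G′_□(·; parKnitY)`
as soon as `near □ ⊇ S □ ∪ knitReachY … (S □)` (✓`B9KnitTransporterLocalityY.GpDirY_parKnitY_congr_of_agreeWalkYO`).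
[cite: Balaban1985BackgroundPropagators, p.394 L30–33 («They depend on the configuration U restricted to Ω₀»), p.410 L14–15, (3.19) p.393] -/
theorem hOagr_GpDirY_of_agreeWalkYO {R₁ R₂ : RegFamY d ℓ hd hL b₀ b₁ Mstar (Matrix (Fin N) (Fin N) ℂ)}
    (near S : ↥(cubes x.toKIdx.D.toDomains) → Finset (SiteY x.toKIdx))
    (hSnear : ∀ c', S c' ⊆ near c') (hSblk : ∀ c', knitReachY x.toKIdx c' (S c') ⊆ near c') (c' : ↥(cubes x.toKIdx.D.toDomains))
    {U U' : (bg9YR (Matrix (Fin N) (Fin N) ℂ) (specialUnitaryUnits (Fin N)) R₁ R₂ x).Cfg}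
    (h : agreeWalkYO x (bg9YR (Matrix (Fin N) (Fin N) ℂ) (specialUnitaryUnits (Fin N)) R₁ R₂ x) (fun V => V) (parKnitY x.toKIdx) near c' U U') :
    GpDirY x.toKIdx c' (parKnitY x.toKIdx) (S c') U = GpDirY x.toKIdx c' (parKnitY x.toKIdx) (S c') U' :=
  GpDirY_parKnitY_congr_of_agreeWalkYO x (bg9YR (Matrix (Fin N) (Fin N) ℂ) (specialUnitaryUnits (Fin N)) R₁ R₂ x) (fun V => V) near c' (S c')
    (hSnear c') (hSblk c') h

end Record

end Summit.QuantumFields.YangMills.BalabanUVNodes.N06CubeDirInverseAtRecord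

end
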